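import Literature.AlgebraicGeometry.ModuliOfAbelianVarieties.SiegelFamilyHodgeCircleLocusCMFields
import Literature.AlgebraicGeometry.ModuliOfAbelianVarieties.SiegelFamilyProductLociMumfordTateGroup
import Literature.Geometry.Kaehler.ComplexTorusMumfordTateGroupHodgeCircleProducts
import HarnessLib

/-!
# On `𝔥_{g₁}(K₁) × 𝔥_{g₂}(K₂)` the PAIR OF CM FIELDS decides the Mumford–Tate group of `X_{(Z₁ 0; 0 Z₂)}`:
# every element is `reindex_ε (h_{Z₁}(z₁) 0; 0 h_{Z₂}(z₂))` with `|z₁| = |z₂|`, the group is commutative; for `K₁ = K₂` it is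
# the Deligne torus `z₁ = z₂` (rank 2), for `K₁ ≠ K₂` the full norm torus `T_{K₁} ×_{Nm} T_{K₂}` (rank 3), and
# `reindex_ε (1 0; 0 −1) ∈ MT(X_{(Z₁ 0; 0 Z₂)})(ℝ)` ⟺ `K₁ ≠ K₂`
# (Moonen 1999 (1.13), Moonen 2004 Lemma 4.6 / Exercise (5.6), Lombardo 2019 §2.2, CMSP 2017 15.2.4 (ii), Silverman 1994 II Ex. 2.3)

Layer `Literature/AlgebraicGeometry/ModuliOfAbelianVarieties`, namespace
`Literature.AlgebraicGeometry.ModuliOfAbelianVarieties.SiegelModuli`; lane `lit-hodgefound` (Track 2 foundations library,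
Layer A4 «Siegel family; special loci; Mumford–Tate groups»), prover seat p17, generation 33, self-proposed row g33-#4 — the
moduli reading of g33-#3 (`ComplexTorusMumfordTateGroupHodgeCircleProducts`: `MT(X₁ × X₂)(ℝ)` for two tori on the
Hodge-circle locus, both branches) on g32-#5's `𝔥_{g₁}(K₁) × 𝔥_{g₂}(K₂)` (`SiegelFamilyHodgeCircleLocusCMFields`: `Hom ≠ 0` ⟺
`K₁ = K₂`, `homRat_prinPeriod_ne_bot_iff_quadraticField_eq`; `coe_hodgeGroup_prinPeriod_eq_range_of_mem_siegelPointsIn`), moved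
to the block-diagonal point by g30-#11's transport (`SiegelFamilyProductLociMumfordTateGroup`:
`mem_mumfordTateGroup_prinPeriod_blockDiagPoint_iff` — `MT(X_{(Z₁ 0; 0 Z₂)})(ℝ) = reindex_ε MT(X_{Z₁} × X_{Z₂})(ℝ)` — and
`hodgeS_prinPeriod_blockDiagPoint_eq_reindex_fromBlocks`).  All consumed BY NAME.  THEOREMS ONLY: no definition, no instance,
no named fact (D-0026, net debt 0); the g30-#13 file `SiegelFamilyProductLociMumfordTateGroupEllipticBlocks` (non-isogenous
ELLIPTIC blocks, `det A = det B`) is the `g₁ = g₂ = 1` shape of §2 with the fields left implicit.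

## Sources, verbatim

* B. Moonen, *Notes on Mumford–Tate groups* (1999), (1.13) Remark: «`MT(V)` is almost never equal to `MT(V₁) × MT(V₂)`, as the
  central factor `𝔾_m = 𝔾_m · id` is counted twice»; B. Moonen, *An introduction to Mumford–Tate groups* (2004), §4 Lemma 4.6,
  §5 (5.2), (5.6) Exercise («`E₁` and `E₂` are isogenous if and only if there is a non-zero … Hodge class in `Hom(V₁, V₂)`»).
* D. Lombardo (2019), §2.2 case 5 («two non-isogenous elliptic curves … rank 3 … `𝔾_m · (M₁ × M₂)`, `M_i = {x x̄ = 1}` if `F_i`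
  is imaginary quadratic») and case 6 («`𝔾_m · {(x, x) | x ∈ M}`»).
* J. Carlson, S. Müller-Stach, C. Peters (2017), §15.2 Examples 15.2.4 (ii) («`MT(H¹(C))(ℚ) = Res_{K/ℚ} K^×`»), Problem 15.2.3 (a).
* J. Silverman (1994), Ch. II Exercise 2.3 («`E'` is isogenous to `E` if and only if `End(E') ⊗ ℚ ≅ K`»); H. Lange (2023),
  §2.6.3 Exercise (2) (iii); H. Imai (1976), §3 (ii) («`Kᵢ = Q(√−dᵢ)` the CM-field corresponding to `Eᵢ`»).

## What is proved (`Kᵢ` imaginary quadratic, `Zᵢ ∈ 𝔥_{gᵢ}(Kᵢ)`, `gᵢ ≥ 1`; `Z = (Z₁ 0; 0 Z₂) = blockDiagPoint e Z₁ Z₂ ∈ 𝔥_g`,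
`ε` the induced permutation of the symplectic coordinates `(λ, μ)`; `h_Z = hodgeS (prinPeriod Z)`)

* §1 **BOTH CASES**: every `N ∈ MT(X_Z)(ℝ)` is `reindex_ε (h_{Z₁}(z₁) 0; 0 h_{Z₂}(z₂))` with `zᵢ ≠ 0`, `|z₁| = |z₂|`
  (`exists_eq_reindex_fromBlocks_hodgeS_of_mem_mumfordTateGroup_prinPeriod_blockDiagPoint`); `MT(X_Z)(ℝ)` is COMMUTATIVE
  (`X_Z` is of CM type).
* §2 **`K₁ ≠ K₂`: `N ∈ MT(X_Z)(ℝ)` ⟺ `N = reindex_ε (h_{Z₁}(z₁) 0; 0 h_{Z₂}(z₂))`, `z₁ ≠ 0`, `|z₁| = |z₂|`** (rank 3), the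
  fibre product `reindex_ε (A 0; 0 B) ∈ MT(X_Z) ⟺ A ∈ MT(X_{Z₁}) ∧ B ∈ MT(X_{Z₂}) ∧ det(A)^{2g₂} = det(B)^{2g₁}`,
  `reindex_ε (1 0; 0 −1) ∈ MT(X_Z)(ℝ)`, and `MT(X_Z)(ℝ) ∩ SL = Hg(X_Z)(ℝ)` exactly.
* §3 **`K₁ = K₂`: `N ∈ MT(X_Z)(ℝ)` ⟺ `N = h_Z(z) = reindex_ε (h_{Z₁}(z) 0; 0 h_{Z₂}(z))`, ONE `z ≠ 0`** (rank 2, the Deligne torus).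
* §4 **THE PAIR OF FIELDS DECIDES: `reindex_ε (1 0; 0 −1) ∈ MT(X_Z)(ℝ)` ⟺ `K₁ ≠ K₂`**; `𝔥₁ × 𝔥₁ → 𝔥₂` spelled out.

## References

* [Moonen1999MTNotes] B. Moonen (1999), (1.11), (1.13). [cite: Moonen1999MTNotes, (1.11) and (1.13) Remark]
* [Moonen2004MT] B. Moonen (2004), §4 Lemma 4.6, §5 (5.2), (5.6) Exercise. [cite: Moonen2004MT, §4 Lemma 4.6, §5 (5.2) and (5.6) Exercise with Hint]
* [Lombardo2019] D. Lombardo, Math. Comp. 88 (2019), §2.2 cases 5, 6. [cite: Lombardo2019, §2.2 cases 5 and 6 (arXiv:1610.09674 p. 4)]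
* [CarlsonMullerStachPeters2017] J. Carlson, S. Müller-Stach, C. Peters (2017), §15.2 Problem 15.2.3 (a), Examples 15.2.4 (ii).
  [cite: CarlsonMullerStachPeters2017, §15.2 Problem 15.2.3 (a) and Examples 15.2.4 (ii)]
* [Silverman1994] J. Silverman, GTM 151 (1994), Ch. II Exercise 2.3. [cite: Silverman1994, Ch. II Exercise 2.3 (PDF p. 174)]
* [Lange2023AbelianVarietiesComplex] H. Lange (2023), §2.6.3 Exercise (2) (iii), §7.2.1 Remark 7.2.2 (2). [cite: Lange2023AbelianVarietiesComplex, §2.6.3 Exercise (2) (iii) and §7.2.1 Remark 7.2.2 (2)]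
* [Imai1976HodgeGroups] H. Imai (1976), §2 Proposition, §3 (ii). [cite: Imai1976HodgeGroups, §2 Proposition (p. 368) and §3 (ii) (p. 371)]
-/

noncomputable section

open scoped Matrix Classical
open Matrix Function Set Module

namespace Literature.AlgebraicGeometry.ModuliOfAbelianVarieties

namespace SiegelModuli

open Literature.NumberTheory.Automorphic
open Literature.NumberTheory.ModularForms Literature.NumberTheory.ModularForms.SiegelUpperHalfSpace
open Literature.NumberTheory.ComplexMultiplication Literature.NumberTheory.ComplexMultiplication.SiegelCMPoint
open Literature.Geometry.Kaehler Literature.Geometry.Kaehler.ComplexTorus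

variable {g g₁ g₂ : ℕ} (e : Fin g₁ ⊕ Fin g₂ ≃ Fin g) {ε : (Fin g₁ ⊕ Fin g₁) ⊕ (Fin g₂ ⊕ Fin g₂) ≃ Fin g ⊕ Fin g}
  {K₁ K₂ : IntermediateField ℚ ℂ} {Z₁ : siegelUpperHalfSpace g₁} {Z₂ : siegelUpperHalfSpace g₂}

/-- `0 < g` ⟹ `0 < dim_ℂ ℂ^g`. [folklore] -/
private theorem finrank_fin_fun_complex_pos₆ {n : ℕ} (hn : 0 < n) : 0 < finrank ℂ (Fin n → ℂ) := by
  rw [Module.finrank_fin_fun]; exact hn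

/-! ## §1 Both cases: `N = reindex_ε (h_{Z₁}(z₁) 0; 0 h_{Z₂}(z₂))`, `|z₁| = |z₂|`; `MT(X_Z)(ℝ)` commutative -/

section Both

/-- **EVERY `N ∈ MT(X_{(Z₁ 0; 0 Z₂)})(ℝ)` IS `reindex_ε (h_{Z₁}(z₁) 0; 0 h_{Z₂}(z₂))` WITH `z₁, z₂ ≠ 0` AND `|z₁| = |z₂|`** for
`Zᵢ ∈ 𝔥_{gᵢ}(Kᵢ)` (both blocks on the Hodge-circle locus; the multiplier is counted once).
[cite: Moonen2004MT, §4 Lemma 4.6 and §5 (5.2)] [cite: Moonen1999MTNotes, (1.13) Remark] [cite: CarlsonMullerStachPeters2017, §15.2 Examples 15.2.4 (ii)] -/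
theorem exists_eq_reindex_fromBlocks_hodgeS_of_mem_mumfordTateGroup_prinPeriod_blockDiagPoint (hg₁ : 0 < g₁) (hg₂ : 0 < g₂)
    (hK₁ : finrank ℚ K₁ = 2) (hK₂ : finrank ℚ K₂ = 2) (hZ₁ : Z₁ ∈ siegelPointsIn (K₁ : Set ℂ))
    (hZ₂ : Z₂ ∈ siegelPointsIn (K₂ : Set ℂ))
    (h₁ : ∀ i, ε (Sum.inl (Sum.inl i)) = Sum.inl (e (Sum.inl i))) (h₂ : ∀ i, ε (Sum.inl (Sum.inr i)) = Sum.inr (e (Sum.inl i)))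
    (h₃ : ∀ j, ε (Sum.inr (Sum.inl j)) = Sum.inl (e (Sum.inr j))) (h₄ : ∀ j, ε (Sum.inr (Sum.inr j)) = Sum.inr (e (Sum.inr j)))
    {N : GL (Fin g ⊕ Fin g) ℝ} (hN : N ∈ mumfordTateGroup (prinPeriod (blockDiagPoint e Z₁ Z₂))) :
    ∃ z₁ z₂ : ℂ, z₁ ≠ 0 ∧ z₂ ≠ 0 ∧ ‖z₁‖ = ‖z₂‖ ∧
      (N : Matrix (Fin g ⊕ Fin g) (Fin g ⊕ Fin g) ℝ) =
        Matrix.reindex ε ε (fromBlocks (hodgeS (prinPeriod Z₁) z₁) 0 0 (hodgeS (prinPeriod Z₂) z₂)) := by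
  obtain ⟨M, hM, hMN⟩ := (mem_mumfordTateGroup_prinPeriod_blockDiagPoint_iff e Z₁ Z₂ h₁ h₂ h₃ h₄).1 hN
  obtain ⟨z₁, z₂, hz₁, hz₂, hnorm, hM'⟩ := exists_eq_fromBlocks_hodgeS_of_mem_mumfordTateGroup_prodPeriod _ _
    (finrank_fin_fun_complex_pos₆ hg₁) (finrank_fin_fun_complex_pos₆ hg₂)
    (coe_hodgeGroup_prinPeriod_eq_range_of_mem_siegelPointsIn hg₁ hK₁ hZ₁)
    (coe_hodgeGroup_prinPeriod_eq_range_of_mem_siegelPointsIn hg₂ hK₂ hZ₂) hM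
  exact ⟨z₁, z₂, hz₁, hz₂, hnorm, by rw [← hMN, hM']⟩

/-- **`MT(X_{(Z₁ 0; 0 Z₂)})(ℝ)` IS COMMUTATIVE for `Zᵢ ∈ 𝔥_{gᵢ}(Kᵢ)`, whatever the two fields** (`X_{(Z₁ 0; 0 Z₂)} ∼ E_{τ₁}^{g₁} × E_{τ₂}^{g₂}`
is of CM type). [cite: Lombardo2019, §2.2 cases 5 and 6] [cite: CarlsonMullerStachPeters2017, §15.2 Examples 15.2.4 (ii)] -/
theorem mumfordTateGroup_prinPeriod_blockDiagPoint_comm_of_mem_siegelPointsIn (hg₁ : 0 < g₁) (hg₂ : 0 < g₂)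
    (hK₁ : finrank ℚ K₁ = 2) (hK₂ : finrank ℚ K₂ = 2) (hZ₁ : Z₁ ∈ siegelPointsIn (K₁ : Set ℂ))
    (hZ₂ : Z₂ ∈ siegelPointsIn (K₂ : Set ℂ))
    (h₁ : ∀ i, ε (Sum.inl (Sum.inl i)) = Sum.inl (e (Sum.inl i))) (h₂ : ∀ i, ε (Sum.inl (Sum.inr i)) = Sum.inr (e (Sum.inl i)))
    (h₃ : ∀ j, ε (Sum.inr (Sum.inl j)) = Sum.inl (e (Sum.inr j))) (h₄ : ∀ j, ε (Sum.inr (Sum.inr j)) = Sum.inr (e (Sum.inr j)))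
    {N N' : GL (Fin g ⊕ Fin g) ℝ} (hN : N ∈ mumfordTateGroup (prinPeriod (blockDiagPoint e Z₁ Z₂)))
    (hN' : N' ∈ mumfordTateGroup (prinPeriod (blockDiagPoint e Z₁ Z₂))) : N * N' = N' * N := by
  obtain ⟨M, hM, hMN⟩ := (mem_mumfordTateGroup_prinPeriod_blockDiagPoint_iff e Z₁ Z₂ h₁ h₂ h₃ h₄).1 hN
  obtain ⟨M', hM', hMN'⟩ := (mem_mumfordTateGroup_prinPeriod_blockDiagPoint_iff e Z₁ Z₂ h₁ h₂ h₃ h₄).1 hN'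
  have hc := mumfordTateGroup_prodPeriod_comm_of_coe_eq_range_of_coe_eq_range _ _ (finrank_fin_fun_complex_pos₆ hg₁)
    (finrank_fin_fun_complex_pos₆ hg₂) (coe_hodgeGroup_prinPeriod_eq_range_of_mem_siegelPointsIn hg₁ hK₁ hZ₁)
    (coe_hodgeGroup_prinPeriod_eq_range_of_mem_siegelPointsIn hg₂ hK₂ hZ₂) hM hM'
  have hmul : ∀ A B : Matrix ((Fin g₁ ⊕ Fin g₁) ⊕ (Fin g₂ ⊕ Fin g₂)) ((Fin g₁ ⊕ Fin g₁) ⊕ (Fin g₂ ⊕ Fin g₂)) ℝ,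
      Matrix.reindex ε ε (A * B) = Matrix.reindex ε ε A * Matrix.reindex ε ε B := fun A B ↦ by
    simp only [Matrix.reindex_apply, Matrix.submatrix_mul_equiv]
  refine Units.ext ?_
  rw [Units.val_mul, Units.val_mul, ← hMN, ← hMN', ← hmul, ← hmul, ← Units.val_mul, ← Units.val_mul, hc]

end Both

/-! ## §2 `K₁ ≠ K₂`: the rank-3 torus `reindex_ε {(h_{Z₁}(z₁) 0; 0 h_{Z₂}(z₂)) : |z₁| = |z₂| ≠ 0}` -/

section Distinct

/-- **`K₁ ≠ K₂`: `N ∈ MT(X_{(Z₁ 0; 0 Z₂)})(ℝ)` ⟺ `N = reindex_ε (h_{Z₁}(z₁) 0; 0 h_{Z₂}(z₂))` with `z₁ ≠ 0`, `|z₁| = |z₂|`**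
(`Hom(X_{Z₁}, X_{Z₂}) = 0` for different fields; Lombardo's `𝔾_m · (U(1) × U(1))`, rank 3).
[cite: Lombardo2019, §2.2 case 5] [cite: Moonen2004MT, §5 (5.6) Exercise with Hint] [cite: Silverman1994, Ch. II Exercise 2.3 (PDF p. 174)] -/
theorem mem_mumfordTateGroup_prinPeriod_blockDiagPoint_iff_of_quadraticField_ne (hg₁ : 0 < g₁) (hg₂ : 0 < g₂)
    (hK₁ : finrank ℚ K₁ = 2) (hK₂ : finrank ℚ K₂ = 2) (hZ₁ : Z₁ ∈ siegelPointsIn (K₁ : Set ℂ))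
    (hZ₂ : Z₂ ∈ siegelPointsIn (K₂ : Set ℂ)) (hne : K₁ ≠ K₂)
    (h₁ : ∀ i, ε (Sum.inl (Sum.inl i)) = Sum.inl (e (Sum.inl i))) (h₂ : ∀ i, ε (Sum.inl (Sum.inr i)) = Sum.inr (e (Sum.inl i)))
    (h₃ : ∀ j, ε (Sum.inr (Sum.inl j)) = Sum.inl (e (Sum.inr j))) (h₄ : ∀ j, ε (Sum.inr (Sum.inr j)) = Sum.inr (e (Sum.inr j)))
    {N : GL (Fin g ⊕ Fin g) ℝ} :
    N ∈ mumfordTateGroup (prinPeriod (blockDiagPoint e Z₁ Z₂)) ↔ ∃ z₁ z₂ : ℂ, z₁ ≠ 0 ∧ ‖z₁‖ = ‖z₂‖ ∧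
      (N : Matrix (Fin g ⊕ Fin g) (Fin g ⊕ Fin g) ℝ) =
        Matrix.reindex ε ε (fromBlocks (hodgeS (prinPeriod Z₁) z₁) 0 0 (hodgeS (prinPeriod Z₂) z₂)) := by
  have h12 : homRat (prinPeriod Z₁ : (Fin g₁ ⊕ Fin g₁ → ℝ) ≃L[ℝ] (Fin g₁ → ℂ))
      (prinPeriod Z₂ : (Fin g₂ ⊕ Fin g₂ → ℝ) ≃L[ℝ] (Fin g₂ → ℂ)) = ⊥ :=
    not_not.1 fun h ↦ hne ((homRat_prinPeriod_ne_bot_iff_quadraticField_eq hg₁ hg₂ hK₁ hK₂ hZ₁ hZ₂).1 h)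
  have key := fun M : GL ((Fin g₁ ⊕ Fin g₁) ⊕ (Fin g₂ ⊕ Fin g₂)) ℝ ↦
    mem_mumfordTateGroup_prodPeriod_iff_of_coe_eq_range_of_homRat_eq_bot _ _ (finrank_fin_fun_complex_pos₆ hg₁)
      (finrank_fin_fun_complex_pos₆ hg₂) (coe_hodgeGroup_prinPeriod_eq_range_of_mem_siegelPointsIn hg₁ hK₁ hZ₁)
      (coe_hodgeGroup_prinPeriod_eq_range_of_mem_siegelPointsIn hg₂ hK₂ hZ₂) h12 (M := M)
  rw [mem_mumfordTateGroup_prinPeriod_blockDiagPoint_iff e Z₁ Z₂ h₁ h₂ h₃ h₄]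
  constructor
  · rintro ⟨M, hM, hMN⟩
    obtain ⟨z₁, z₂, hz₁, hnorm, hM'⟩ := (key M).1 hM
    exact ⟨z₁, z₂, hz₁, hnorm, by rw [← hMN, hM']⟩
  · rintro ⟨z₁, z₂, hz₁, hnorm, hN⟩
    -- the block matrix is invertible (it is `reindex_ε⁻¹ N`), so it is the matrix of a unit `M`
    have hdet : IsUnit (fromBlocks (hodgeS (prinPeriod Z₁) z₁) 0 0 (hodgeS (prinPeriod Z₂) z₂)).det := by
      have hu : IsUnit (N : Matrix (Fin g ⊕ Fin g) (Fin g ⊕ Fin g) ℝ).det :=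
        (Matrix.isUnit_iff_isUnit_det _).1 (Units.isUnit N)
      rwa [hN, Matrix.det_reindex_self] at hu
    set M : GL ((Fin g₁ ⊕ Fin g₁) ⊕ (Fin g₂ ⊕ Fin g₂)) ℝ :=
      Matrix.GeneralLinearGroup.mk'' _ hdet with hMdef
    have hMcoe : (M : Matrix _ _ ℝ) = fromBlocks (hodgeS (prinPeriod Z₁) z₁) 0 0 (hodgeS (prinPeriod Z₂) z₂) := rfl
    exact ⟨M, (key M).2 ⟨z₁, z₂, hz₁, hnorm, hMcoe⟩, by rw [hMcoe, hN]⟩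

/-- **`K₁ ≠ K₂`: THE FIBRE PRODUCT `reindex_ε (A 0; 0 B) ∈ MT(X_{(Z₁ 0; 0 Z₂)})(ℝ)` ⟺ `A ∈ MT(X_{Z₁})(ℝ)`, `B ∈ MT(X_{Z₂})(ℝ)`,
`det(A)^{2g₂} = det(B)^{2g₁}`** — `MT(X_{(Z₁ 0; 0 Z₂)}) = MT(X_{Z₁}) ×_{𝔾_m} MT(X_{Z₂})` for different fields (equality in
Moonen's (5.2); for equal fields the inclusion is proper, §4). [cite: Moonen2004MT, §5 (5.2) and §4 Lemma 4.6]
[cite: Moonen1999MTNotes, (1.13) Remark] [cite: CarlsonMullerStachPeters2017, §15.2 Problem 15.2.3 (a)] -/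
theorem reindex_fromBlocks_mem_mumfordTateGroup_prinPeriod_blockDiagPoint_iff_of_quadraticField_ne (hg₁ : 0 < g₁)
    (hg₂ : 0 < g₂) (hK₁ : finrank ℚ K₁ = 2) (hK₂ : finrank ℚ K₂ = 2) (hZ₁ : Z₁ ∈ siegelPointsIn (K₁ : Set ℂ))
    (hZ₂ : Z₂ ∈ siegelPointsIn (K₂ : Set ℂ)) (hne : K₁ ≠ K₂)
    (h₁ : ∀ i, ε (Sum.inl (Sum.inl i)) = Sum.inl (e (Sum.inl i))) (h₂ : ∀ i, ε (Sum.inl (Sum.inr i)) = Sum.inr (e (Sum.inl i)))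
    (h₃ : ∀ j, ε (Sum.inr (Sum.inl j)) = Sum.inl (e (Sum.inr j))) (h₄ : ∀ j, ε (Sum.inr (Sum.inr j)) = Sum.inr (e (Sum.inr j)))
    {A : GL (Fin g₁ ⊕ Fin g₁) ℝ} {B : GL (Fin g₂ ⊕ Fin g₂) ℝ} {N : GL (Fin g ⊕ Fin g) ℝ}
    (hNAB : (N : Matrix (Fin g ⊕ Fin g) (Fin g ⊕ Fin g) ℝ) =
      Matrix.reindex ε ε (fromBlocks (A : Matrix _ _ ℝ) 0 0 (B : Matrix _ _ ℝ))) :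
    N ∈ mumfordTateGroup (prinPeriod (blockDiagPoint e Z₁ Z₂)) ↔
      A ∈ mumfordTateGroup (prinPeriod Z₁) ∧ B ∈ mumfordTateGroup (prinPeriod Z₂) ∧
        (A : Matrix (Fin g₁ ⊕ Fin g₁) (Fin g₁ ⊕ Fin g₁) ℝ).det ^ (2 * g₂) =
          (B : Matrix (Fin g₂ ⊕ Fin g₂) (Fin g₂ ⊕ Fin g₂) ℝ).det ^ (2 * g₁) := by
  refine ⟨mem_mumfordTateGroup_prinPeriod_of_reindex_fromBlocks_mem e Z₁ Z₂ h₁ h₂ h₃ h₄ hNAB, fun ⟨hA, hB, hdet⟩ ↦ ?_⟩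
  have h12 : homRat (prinPeriod Z₁ : (Fin g₁ ⊕ Fin g₁ → ℝ) ≃L[ℝ] (Fin g₁ → ℂ))
      (prinPeriod Z₂ : (Fin g₂ ⊕ Fin g₂ → ℝ) ≃L[ℝ] (Fin g₂ → ℂ)) = ⊥ :=
    not_not.1 fun h ↦ hne ((homRat_prinPeriod_ne_bot_iff_quadraticField_eq hg₁ hg₂ hK₁ hK₂ hZ₁ hZ₂).1 h)
  have hdet' : (A : Matrix (Fin g₁ ⊕ Fin g₁) (Fin g₁ ⊕ Fin g₁) ℝ).det ^ Fintype.card (Fin g₂ ⊕ Fin g₂) =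
      (B : Matrix (Fin g₂ ⊕ Fin g₂) (Fin g₂ ⊕ Fin g₂) ℝ).det ^ Fintype.card (Fin g₁ ⊕ Fin g₁) := by
    simpa only [Fintype.card_sum, Fintype.card_fin, two_mul] using hdet
  have hM := (blockDiagGL_mem_mumfordTateGroup_prodPeriod_iff_of_coe_eq_range_of_homRat_eq_bot _ _
    (finrank_fin_fun_complex_pos₆ hg₁) (finrank_fin_fun_complex_pos₆ hg₂)
    (coe_hodgeGroup_prinPeriod_eq_range_of_mem_siegelPointsIn hg₁ hK₁ hZ₁)
    (coe_hodgeGroup_prinPeriod_eq_range_of_mem_siegelPointsIn hg₂ hK₂ hZ₂) h12).2 ⟨hA, hB, hdet'⟩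
  exact (mem_mumfordTateGroup_prinPeriod_blockDiagPoint_iff e Z₁ Z₂ h₁ h₂ h₃ h₄).2
    ⟨_, hM, by rw [ComplexTorus.coe_blockDiagGL, hNAB]⟩

/-- **`K₁ ≠ K₂`: `reindex_ε (1 0; 0 −1) ∈ MT(X_{(Z₁ 0; 0 Z₂)})(ℝ)`** (`= reindex_ε (h_{Z₁}(1) 0; 0 h_{Z₂}(−1))`, `|1| = |−1|`).
[cite: Moonen2004MT, §5 (5.6) Exercise, Hint] [cite: Lombardo2019, §2.2 case 5] -/
theorem mem_mumfordTateGroup_prinPeriod_blockDiagPoint_of_coe_eq_reindex_one_neg_one_of_quadraticField_ne (hg₁ : 0 < g₁)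
    (hg₂ : 0 < g₂) (hK₁ : finrank ℚ K₁ = 2) (hK₂ : finrank ℚ K₂ = 2) (hZ₁ : Z₁ ∈ siegelPointsIn (K₁ : Set ℂ))
    (hZ₂ : Z₂ ∈ siegelPointsIn (K₂ : Set ℂ)) (hne : K₁ ≠ K₂)
    (h₁ : ∀ i, ε (Sum.inl (Sum.inl i)) = Sum.inl (e (Sum.inl i))) (h₂ : ∀ i, ε (Sum.inl (Sum.inr i)) = Sum.inr (e (Sum.inl i)))
    (h₃ : ∀ j, ε (Sum.inr (Sum.inl j)) = Sum.inl (e (Sum.inr j))) (h₄ : ∀ j, ε (Sum.inr (Sum.inr j)) = Sum.inr (e (Sum.inr j)))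
    {N : GL (Fin g ⊕ Fin g) ℝ}
    (hN : (N : Matrix (Fin g ⊕ Fin g) (Fin g ⊕ Fin g) ℝ) =
      Matrix.reindex ε ε (fromBlocks (1 : Matrix (Fin g₁ ⊕ Fin g₁) (Fin g₁ ⊕ Fin g₁) ℝ) 0 0 (-1))) :
    N ∈ mumfordTateGroup (prinPeriod (blockDiagPoint e Z₁ Z₂)) :=
  (mem_mumfordTateGroup_prinPeriod_blockDiagPoint_iff_of_quadraticField_ne e hg₁ hg₂ hK₁ hK₂ hZ₁ hZ₂ hne h₁ h₂ h₃ h₄).2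
    ⟨1, -1, one_ne_zero, by rw [norm_neg], by
      rw [hN, ← Complex.ofReal_one, hodgeS_ofReal, one_smul, ← Complex.ofReal_neg, hodgeS_ofReal, neg_smul, one_smul]⟩

/-- **`K₁ ≠ K₂`: `MT(X_{(Z₁ 0; 0 Z₂)})(ℝ) ∩ SL = Hg(X_{(Z₁ 0; 0 Z₂)})(ℝ)` EXACTLY** — an element of `SL_{2g}(ℝ)` lies in the Hodge
group iff it lies in the Mumford–Tate group (no finite-index defect between `𝔾_m · Hg` and `MT` on real points at these
points). [cite: Lange2023AbelianVarietiesComplex, §7.2.1 Remark 7.2.2 (2)] [cite: Moonen1999MTNotes, (1.11)] -/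
theorem mem_hodgeGroup_prinPeriod_blockDiagPoint_iff_toGL_mem_of_quadraticField_ne (hg₁ : 0 < g₁) (hg₂ : 0 < g₂)
    (hK₁ : finrank ℚ K₁ = 2) (hK₂ : finrank ℚ K₂ = 2) (hZ₁ : Z₁ ∈ siegelPointsIn (K₁ : Set ℂ))
    (hZ₂ : Z₂ ∈ siegelPointsIn (K₂ : Set ℂ)) (hne : K₁ ≠ K₂)
    (h₁ : ∀ i, ε (Sum.inl (Sum.inl i)) = Sum.inl (e (Sum.inl i))) (h₂ : ∀ i, ε (Sum.inl (Sum.inr i)) = Sum.inr (e (Sum.inl i)))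
    (h₃ : ∀ j, ε (Sum.inr (Sum.inl j)) = Sum.inl (e (Sum.inr j))) (h₄ : ∀ j, ε (Sum.inr (Sum.inr j)) = Sum.inr (e (Sum.inr j)))
    (N : Matrix.SpecialLinearGroup (Fin g ⊕ Fin g) ℝ) :
    N ∈ hodgeGroup (prinPeriod (blockDiagPoint e Z₁ Z₂)) ↔
      (Matrix.SpecialLinearGroup.toGL N : GL (Fin g ⊕ Fin g) ℝ) ∈ mumfordTateGroup (prinPeriod (blockDiagPoint e Z₁ Z₂)) := by
  refine ⟨toGL_mem_mumfordTateGroup _, fun hN ↦ ?_⟩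
  have h12 : homRat (prinPeriod Z₁ : (Fin g₁ ⊕ Fin g₁ → ℝ) ≃L[ℝ] (Fin g₁ → ℂ))
      (prinPeriod Z₂ : (Fin g₂ ⊕ Fin g₂ → ℝ) ≃L[ℝ] (Fin g₂ → ℂ)) = ⊥ :=
    not_not.1 fun h ↦ hne ((homRat_prinPeriod_ne_bot_iff_quadraticField_eq hg₁ hg₂ hK₁ hK₂ hZ₁ hZ₂).1 h)
  obtain ⟨M, hM, hMN⟩ := (mem_mumfordTateGroup_prinPeriod_blockDiagPoint_iff e Z₁ Z₂ h₁ h₂ h₃ h₄).1 hN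
  rw [Matrix.SpecialLinearGroup.coe_GL_coe_matrix] at hMN
  -- `det M = det N = 1`: `M` comes from `SL`
  have hdetM : (M : Matrix ((Fin g₁ ⊕ Fin g₁) ⊕ (Fin g₂ ⊕ Fin g₂)) ((Fin g₁ ⊕ Fin g₁) ⊕ (Fin g₂ ⊕ Fin g₂)) ℝ).det = 1 := by
    have h := congrArg Matrix.det hMN
    rwa [Matrix.det_reindex_self, N.2] at h
  have hM₀ : (Matrix.SpecialLinearGroup.toGL
      (⟨(M : Matrix _ _ ℝ), hdetM⟩ : Matrix.SpecialLinearGroup ((Fin g₁ ⊕ Fin g₁) ⊕ (Fin g₂ ⊕ Fin g₂)) ℝ) : GL _ ℝ) = M :=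
    Units.ext rfl
  have hM₀mem : (⟨(M : Matrix _ _ ℝ), hdetM⟩ : Matrix.SpecialLinearGroup ((Fin g₁ ⊕ Fin g₁) ⊕ (Fin g₂ ⊕ Fin g₂)) ℝ) ∈
      hodgeGroup (prodPeriod (prinPeriod Z₁) (prinPeriod Z₂)) := by
    refine (mem_hodgeGroup_prodPeriod_iff_toGL_mem_mumfordTateGroup_of_homRat_eq_bot _ _ (finrank_fin_fun_complex_pos₆ hg₁)
      (finrank_fin_fun_complex_pos₆ hg₂) (coe_hodgeGroup_prinPeriod_eq_range_of_mem_siegelPointsIn hg₁ hK₁ hZ₁)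
      (coe_hodgeGroup_prinPeriod_eq_range_of_mem_siegelPointsIn hg₂ hK₂ hZ₂) h12 _).2 ?_
    rw [hM₀]
    exact hM
  rw [hodgeGroup_prinPeriod_blockDiagPoint_eq_map e Z₁ Z₂ h₁ h₂ h₃ h₄]
  exact Subgroup.mem_map.2 ⟨_, hM₀mem, Subtype.ext (by rw [coe_reindexSL]; exact hMN)⟩

end Distinct

/-! ## §3 `K₁ = K₂`: the Deligne torus `h_Z(ℂ^×)`, one parameter -/

section Equal

/-- **`K₁ = K₂`: `N ∈ MT(X_{(Z₁ 0; 0 Z₂)})(ℝ)` ⟺ `N = h_Z(z) = reindex_ε (h_{Z₁}(z) 0; 0 h_{Z₂}(z))`, ONE `z ≠ 0`** (the product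
is on the Hodge-circle locus, `MT = h(ℂ^×)`, g32-#5; Lombardo's `𝔾_m · {(x, x)}`, rank 2). [cite: Lombardo2019, §2.2 case 6]
[cite: CarlsonMullerStachPeters2017, §15.2 Examples 15.2.4 (ii)] [cite: Moonen2004MT, §5 (5.6) Exercise, Hint] -/
theorem mem_mumfordTateGroup_prinPeriod_blockDiagPoint_iff_of_quadraticField_eq (hg₁ : 0 < g₁) (hg₂ : 0 < g₂)
    (hK₁ : finrank ℚ K₁ = 2) (hK₂ : finrank ℚ K₂ = 2) (hZ₁ : Z₁ ∈ siegelPointsIn (K₁ : Set ℂ))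
    (hZ₂ : Z₂ ∈ siegelPointsIn (K₂ : Set ℂ)) (heq : K₁ = K₂)
    (h₁ : ∀ i, ε (Sum.inl (Sum.inl i)) = Sum.inl (e (Sum.inl i))) (h₂ : ∀ i, ε (Sum.inl (Sum.inr i)) = Sum.inr (e (Sum.inl i)))
    (h₃ : ∀ j, ε (Sum.inr (Sum.inl j)) = Sum.inl (e (Sum.inr j))) (h₄ : ∀ j, ε (Sum.inr (Sum.inr j)) = Sum.inr (e (Sum.inr j)))
    {N : GL (Fin g ⊕ Fin g) ℝ} :
    N ∈ mumfordTateGroup (prinPeriod (blockDiagPoint e Z₁ Z₂)) ↔ ∃ z : ℂ, z ≠ 0 ∧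
      (N : Matrix (Fin g ⊕ Fin g) (Fin g ⊕ Fin g) ℝ) =
        Matrix.reindex ε ε (fromBlocks (hodgeS (prinPeriod Z₁) z) 0 0 (hodgeS (prinPeriod Z₂) z)) := by
  haveI : Nonempty (Fin g ⊕ Fin g) := ⟨Sum.inl (e (Sum.inl ⟨0, hg₁⟩))⟩
  have hMT := (coe_mumfordTateGroup_prinPeriod_blockDiagPoint_eq_range_iff_quadraticField_eq e hg₁ hg₂ hK₁ hK₂ hZ₁ hZ₂).2 heq
  rw [← SetLike.mem_coe, hMT, mem_range_hodgeSGL_iff]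
  simp only [hodgeS_prinPeriod_blockDiagPoint_eq_reindex_fromBlocks e Z₁ Z₂ h₁ h₂ h₃ h₄]

/-- **`K₁ = K₂`: `reindex_ε (1 0; 0 −1) ∉ MT(X_{(Z₁ 0; 0 Z₂)})(ℝ)`** (`Hom(X_{Z₁}, X_{Z₂}) ≠ 0`: the tree's strictness witness of
g30-#11, here triggered by the fields). [cite: Moonen2004MT, §5 (5.6) Exercise, Hint] [cite: Imai1976HodgeGroups, §3 Remarks (p. 370)] -/
theorem not_mem_mumfordTateGroup_prinPeriod_blockDiagPoint_of_coe_eq_reindex_one_neg_one_of_quadraticField_eq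
    (hg₁ : 0 < g₁) (hg₂ : 0 < g₂) (hK₁ : finrank ℚ K₁ = 2) (hK₂ : finrank ℚ K₂ = 2) (hZ₁ : Z₁ ∈ siegelPointsIn (K₁ : Set ℂ))
    (hZ₂ : Z₂ ∈ siegelPointsIn (K₂ : Set ℂ)) (heq : K₁ = K₂)
    (h₁ : ∀ i, ε (Sum.inl (Sum.inl i)) = Sum.inl (e (Sum.inl i))) (h₂ : ∀ i, ε (Sum.inl (Sum.inr i)) = Sum.inr (e (Sum.inl i)))
    (h₃ : ∀ j, ε (Sum.inr (Sum.inl j)) = Sum.inl (e (Sum.inr j))) (h₄ : ∀ j, ε (Sum.inr (Sum.inr j)) = Sum.inr (e (Sum.inr j)))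
    {N : GL (Fin g ⊕ Fin g) ℝ}
    (hN : (N : Matrix (Fin g ⊕ Fin g) (Fin g ⊕ Fin g) ℝ) =
      Matrix.reindex ε ε (fromBlocks (1 : Matrix (Fin g₁ ⊕ Fin g₁) (Fin g₁ ⊕ Fin g₁) ℝ) 0 0 (-1))) :
    N ∉ mumfordTateGroup (prinPeriod (blockDiagPoint e Z₁ Z₂)) :=
  not_mem_mumfordTateGroup_prinPeriod_blockDiagPoint_of_coe_eq_reindex_one_neg_one e Z₁ Z₂ h₁ h₂ h₃ h₄
    ((homRat_prinPeriod_ne_bot_iff_quadraticField_eq hg₁ hg₂ hK₁ hK₂ hZ₁ hZ₂).2 heq) hN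

end Equal

/-! ## §4 The pair of fields decides: `reindex_ε (1 0; 0 −1) ∈ MT(X_Z)(ℝ)` ⟺ `K₁ ≠ K₂`; `𝔥₁ × 𝔥₁ → 𝔥₂` -/

section Decides

/-- **THE PAIR OF FIELDS DECIDES: `reindex_ε (1 0; 0 −1) ∈ MT(X_{(Z₁ 0; 0 Z₂)})(ℝ)` ⟺ `K₁ ≠ K₂`** — equivalently `MT` is the
rank-3 norm torus iff the fields differ, the rank-2 Deligne torus iff they agree. [cite: Moonen2004MT, §5 (5.6) Exercise with Hint]
[cite: Lombardo2019, §2.2 cases 5 and 6] [cite: Silverman1994, Ch. II Exercise 2.3 (PDF p. 174)] -/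
theorem mem_mumfordTateGroup_prinPeriod_blockDiagPoint_iff_quadraticField_ne_of_coe_eq_reindex_one_neg_one (hg₁ : 0 < g₁)
    (hg₂ : 0 < g₂) (hK₁ : finrank ℚ K₁ = 2) (hK₂ : finrank ℚ K₂ = 2) (hZ₁ : Z₁ ∈ siegelPointsIn (K₁ : Set ℂ))
    (hZ₂ : Z₂ ∈ siegelPointsIn (K₂ : Set ℂ))
    (h₁ : ∀ i, ε (Sum.inl (Sum.inl i)) = Sum.inl (e (Sum.inl i))) (h₂ : ∀ i, ε (Sum.inl (Sum.inr i)) = Sum.inr (e (Sum.inl i)))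
    (h₃ : ∀ j, ε (Sum.inr (Sum.inl j)) = Sum.inl (e (Sum.inr j))) (h₄ : ∀ j, ε (Sum.inr (Sum.inr j)) = Sum.inr (e (Sum.inr j)))
    {N : GL (Fin g ⊕ Fin g) ℝ}
    (hN : (N : Matrix (Fin g ⊕ Fin g) (Fin g ⊕ Fin g) ℝ) =
      Matrix.reindex ε ε (fromBlocks (1 : Matrix (Fin g₁ ⊕ Fin g₁) (Fin g₁ ⊕ Fin g₁) ℝ) 0 0 (-1))) :
    N ∈ mumfordTateGroup (prinPeriod (blockDiagPoint e Z₁ Z₂)) ↔ K₁ ≠ K₂ := by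
  by_cases h : K₁ = K₂
  · exact ⟨fun hmem ↦ absurd hmem
      (not_mem_mumfordTateGroup_prinPeriod_blockDiagPoint_of_coe_eq_reindex_one_neg_one_of_quadraticField_eq e hg₁ hg₂ hK₁
        hK₂ hZ₁ hZ₂ h h₁ h₂ h₃ h₄ hN), fun hne ↦ absurd h hne⟩
  · exact ⟨fun _ ↦ h, fun _ ↦
      mem_mumfordTateGroup_prinPeriod_blockDiagPoint_of_coe_eq_reindex_one_neg_one_of_quadraticField_ne e hg₁ hg₂ hK₁ hK₂ hZ₁
        hZ₂ h h₁ h₂ h₃ h₄ hN⟩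

/-- `𝔥₁(K) = {CM points τ ∈ K}`: a CM point `τ ∈ K ∖ ℝ` of `𝔥₁` lies in `𝔥₁(K)`. [cite: Lange2023AbelianVarietiesComplex, §2.6.3 Exercise (2) (iii)] -/
private theorem mem_siegelPointsIn_one_of_apply_mem {K : IntermediateField ℚ ℂ} {W : siegelUpperHalfSpace 1}
    (hW : (W : Matrix (Fin 1) (Fin 1) ℂ) 0 0 ∈ K) : W ∈ siegelPointsIn (K : Set ℂ) := fun i j ↦ by
  rw [Subsingleton.elim i 0, Subsingleton.elim j 0]; exact hW

/-- **`𝔥₁ × 𝔥₁ → 𝔥₂`, CM POINTS `τ₁ ∈ K₁`, `τ₂ ∈ K₂` WITH `K₁ ≠ K₂`: `N ∈ MT(X_{(τ₁ 0; 0 τ₂)})(ℝ)` ⟺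
`N = reindex_ε (h_{τ₁}(z₁) 0; 0 h_{τ₂}(z₂))`, `|z₁| = |z₂| ≠ 0`** — Exercise (5.6), CM × CM with different fields:
`T_{K₁} ×_{Nm} T_{K₂}` on real points (g30-#13 gave `det A = det B` for any non-isogenous elliptic blocks).
[cite: Moonen2004MT, §5 (5.6) Exercise] [cite: Lombardo2019, §2.2 case 5] [cite: Imai1976HodgeGroups, §3 (ii) (p. 371)] -/
theorem mem_mumfordTateGroup_prinPeriod_blockDiagPoint_one_one_iff_of_quadraticField_ne {e₁ : Fin 1 ⊕ Fin 1 ≃ Fin 2}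
    {ε₁ : (Fin 1 ⊕ Fin 1) ⊕ (Fin 1 ⊕ Fin 1) ≃ Fin 2 ⊕ Fin 2} {W₁ W₂ : siegelUpperHalfSpace 1} (hK₁ : finrank ℚ K₁ = 2)
    (hK₂ : finrank ℚ K₂ = 2) (hW₁ : (W₁ : Matrix (Fin 1) (Fin 1) ℂ) 0 0 ∈ K₁) (hW₂ : (W₂ : Matrix (Fin 1) (Fin 1) ℂ) 0 0 ∈ K₂)
    (hne : K₁ ≠ K₂)
    (h₁ : ∀ i, ε₁ (Sum.inl (Sum.inl i)) = Sum.inl (e₁ (Sum.inl i))) (h₂ : ∀ i, ε₁ (Sum.inl (Sum.inr i)) = Sum.inr (e₁ (Sum.inl i)))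
    (h₃ : ∀ j, ε₁ (Sum.inr (Sum.inl j)) = Sum.inl (e₁ (Sum.inr j))) (h₄ : ∀ j, ε₁ (Sum.inr (Sum.inr j)) = Sum.inr (e₁ (Sum.inr j)))
    {N : GL (Fin 2 ⊕ Fin 2) ℝ} :
    N ∈ mumfordTateGroup (prinPeriod (blockDiagPoint e₁ W₁ W₂)) ↔ ∃ z₁ z₂ : ℂ, z₁ ≠ 0 ∧ ‖z₁‖ = ‖z₂‖ ∧
      (N : Matrix (Fin 2 ⊕ Fin 2) (Fin 2 ⊕ Fin 2) ℝ) =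
        Matrix.reindex ε₁ ε₁ (fromBlocks (hodgeS (prinPeriod W₁) z₁) 0 0 (hodgeS (prinPeriod W₂) z₂)) :=
  mem_mumfordTateGroup_prinPeriod_blockDiagPoint_iff_of_quadraticField_ne e₁ one_pos one_pos hK₁ hK₂
    (mem_siegelPointsIn_one_of_apply_mem hW₁) (mem_siegelPointsIn_one_of_apply_mem hW₂) hne h₁ h₂ h₃ h₄

end Decides

end SiegelModuli

end Literature.AlgebraicGeometry.ModuliOfAbelianVarieties
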